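/-
Copyright (c) 2026 the pub-hodgecm-mathlib formalisation cell (harness21).  Prover seat hodgecm-mathlib-LH4-p04 (g9), req620 Track A «(D-RAM) FOUR-FRAME» squad
((β₂) road (R-36), β₂-BOARD v2 (00b5a5b7) row (L-Σ), brick (L-Σ-3B) ED. 3: ‹ROW› reduced to the WINDOWED cell ledger of the diagonal row), 2026-09-04.
-/
import Summits.HodgeConjecture.HodgeConjecture.Theorems.F0P3cDyRamBeta2ConesBOfRows                  -- ★ p862801 (this seat): fixes ‹ROW.letter.v1› (286070dc), this file's CONCLUSION; brings every token
import Summits.HodgeConjecture.HodgeConjecture.Theorems.F0P3cDyRamRowWindowReduction                -- ★ p862963 (this seat): `rowSum_eq_rowSum_of_window` (over ★ p862919's window arithmetic)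
import Summits.HodgeConjecture.HodgeConjecture.Theorems.F0P3cDyRamAnisotropicUnitFrameIntegrality    -- ★ `anisotropic_of_frame` (the (diag dg, η)-plane has no isotropic vector)
import Literature.NumberTheory.Automorphic.UnitaryLatticeTreeAnisotropicPlane                         -- ★ `pairing_diagonal_two_self`
import Literature.NumberTheory.Automorphic.UnitaryLatticeTreeTypeTwoTransitive                        -- ★ `det_antidiagonal_three`
import HarnessLib

/-!
# Crux `H413`, line LH4 «(D-RAM) FOUR-FRAME» — (β₂) road, β₂-BOARD v2 row (L-Σ), brick (L-Σ-3B) ED. 3: «THE ROW IS ITS WINDOW» —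
# `row_of_core (N) (hWR : ‹WR›) (hcore : ‹CORE›) : ‹ROW.letter.v1 (286070dc) VERBATIM›`

Cell `hodgecm-mathlib` (D-0151), FLOOR 0, crux item H413 = `stmt-HodgeConjecture-24833`, route of record `HCCMUnconditional`; squad F0∕P3c∕LH4; lane
`--supports stmt-HodgeConjecture-24833 --as helper` (count-neutral).  THEOREMS ONLY (no `def`∕instance∕notation∕`sorry`; default heartbeats); GENERIC (no CM token).
‹ROW.letter.v1› (binder `hrow` of ★ p862801; text `F0/P3c/LH4/LH4-p04/g9/ROW.letter.v1.LH4p04g9.lean.txt`): the signed cone totals of the two literals of `beta2ConesB.letter.v2`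
restricted to the tube depth `2b = m` agree.  THIS FILE strips its `Finset` plumbing by ★ p862919∕★-cand `rowSum_eq_rowSum_of_window` (ED. 3-0∕3-1): the filter keeps at most
`b = m∕2`; the guard `IsOrd_j lam` is `j ≤ jl` (‹WR›.1) and truncates the level range; off the progression `j = b + 2i` every cell vanishes (‹WR›.2: `j < b`; odd parity; beyond range
`jl < j + b`; anisotropic-far `b + 2d ≤ j`); a row outside a literal's box `[1, R_t]` is `0` on BOTH sides by the tube bound (‹WR›.3).  What is left is **‹CORE›** (binder `hcore`;
text `…/CORE.letter.v1.LH4p04g9.lean.txt`): over ALL of letter v2's binders, `∀ b, 1 ≤ b → 2b = m → (literal 2's plane anisotropic) → Σ_{i < (jl−m)∕2+1} X_H(b+2i, b) =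
Σ_{i < min ((jl−m)∕2+1) d} X_A(b+2i, b)` — THE WINDOWED CELL LEDGER (ED. 4 cuts it by the sign-free relative cell laws of β₂ WORDS #16∕#17).  **‹WR›** (binder `hWR`; text
`…/WR.letter.v1.LH4p04g9.lean.txt`; holder LH7-p10 (g2), rows (ROW-W)+(ROW-R)) is ONE-LITERAL in ★ p861305 §3's general-block spelling, instantiated at `((Φ₂).over E, 1, 1, γ₂)`
and `(diag dg, η, P₁, γ₁)` as ★ p862801 does for ‹OFF›; literal 2's anisotropy is DERIVED (★ `anisotropic_of_frame` on `det Φ₃ = −1`, `hform′`, ★ `pairing_diagonal_two_self`).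
HONEST LABEL.  A reduction; ‹WR› and ‹CORE› are OPEN hypotheses; β₂ UNPROVED; `HC_CM` is proved only modulo the 7 printed citations (2 remaining named inputs: hLiu418 =
`stmt-HodgeConjecture-24832`, h413 = `stmt-HodgeConjecture-24833`) until rung 0 closes.  References: [Kottwitz1986BaseChangeUnits] §1 pp. 240–241 · [Rogawski1990] §4.9
Prop. 4.9.1 (b) p. 55, Lemma 4.9.3 p. 56 · [Jacobowitz1962] §3–§4.
-/

set_option autoImplicit false

noncomputable section
namespace Summit.HodgeConjecture.HodgeConjecture.Cruxes.H413.F0P3cDyRamRowOfCore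

open scoped Matrix MatrixGroups Classical Valued WithZero
open Literature.NumberTheory.Automorphic Literature.NumberTheory.Automorphic.UnitaryThreeFourFrame Literature.NumberTheory.Automorphic.UnitaryLatticeTree
open Literature.NumberTheory.Automorphic.HermitianLattice Literature.NumberTheory.Automorphic.EllipticPlaneAsFieldLine Literature.NumberTheory.LocalFields.QuadraticOrder
open Literature.NumberTheory.Rogawski1990
open Summit.HodgeConjecture.HodgeConjecture.Cruxes.H413.F0P3cDyRamToricCensusDefs Summit.HodgeConjecture.HodgeConjecture.Cruxes.H413.F0P3cDyRamFourFramePieces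
open Summit.HodgeConjecture.HodgeConjecture.Cruxes.H413.F0P3cDyRamFourFrameCensusDefs Summit.HodgeConjecture.HodgeConjecture.Cruxes.H413.F0P3cDyRamStageOneBDefs
open Summit.HodgeConjecture.HodgeConjecture.Cruxes.H413.F0P3cDyRamAxisColumnZeroOfFrame Summit.HodgeConjecture.HodgeConjecture.Cruxes.H413.F0P3cDyRamRowWindowReduction
open Summit.HodgeConjecture.HodgeConjecture.Cruxes.H413.F0P3cDyRamAnisotropicUnitFrameIntegrality (anisotropic_of_frame)
open Summit.HodgeConjecture.HodgeConjecture.Cruxes.H413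

/-- **(L-Σ-3B) ED. 3 — ‹ROW› FROM THE WINDOW LETTER ‹WR› AND THE WINDOWED CELL LEDGER ‹CORE›** (`N` = the fence parameter, passed through): see the module docstring.
[cite: Kottwitz1986BaseChangeUnits, §1 pp. 240–241] [cite: Rogawski1990, §4.9 Prop. 4.9.1 (b) p. 55, Lemma 4.9.3 p. 56] [cite: Jacobowitz1962, §3–§4] -/
theorem row_of_core (N : ℕ → ℕ → ℕ → ℕ)
    (hWR :
      ∀ (E M : Type) [Field E] [Valued E ℤᵐ⁰] [CompleteSpace E] [IsDiscreteValuationRing 𝒪[E]] [Finite 𝓀[E]]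
        [Field M] [Valued M ℤᵐ⁰] [CompleteSpace M] [IsDiscreteValuationRing 𝒪[M]] [Finite 𝓀[M]]
        (σ : E →+* E) (ϖ : E) (d tE : ℕ) (_hD : IsRamifiedQuadraticDatum σ ϖ d tE) (_hσσ : ∀ a, σ (σ a) = a) (_h2 : ¬ IsUnit (2 : 𝒪[E]))
        (jE : E →+* M) (ρ Θ : M →+* M) (α lam : M)
        (_hρρ : ∀ z, ρ (ρ z) = z) (_hvρ : ∀ z, Valued.v (ρ z) = Valued.v z) (_hρj : ∀ a, ρ (jE a) = jE a)
        (_hjv : ∀ a, Valued.v (jE a) ≤ 1 ↔ Valued.v a ≤ 1) (_hjfix : ∀ z : M, ρ z = z ↔ ∃ a, jE a = z) (_hΘj : ∀ a, Θ (jE a) = jE (σ a))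
        (_hΘΘ : ∀ z, Θ (Θ z) = z) (_hΘρ : ∀ z, Θ (ρ z) = ρ (Θ z)) (_hvΘ : ∀ z, Valued.v (Θ z) = Valued.v z)
        (_hα : ρ α ≠ α) (_hα1 : Valued.v α ≤ 1) (_hint : ∀ z : M, Valued.v z ≤ 1 → Valued.v ((z - ρ z) / (α - ρ α)) ≤ 1)
        (_hΘlam : Θ lam * lam = 1) (_hvlam : Valued.v lam = 1) (_hbasis : ∀ z : M, ∃! pq : E × E, z = jE pq.1 + jE pq.2 * lam)
        (_hU : Valued.v (α - ρ α) = 1) (_hτ : Valued.v (α - Θ α) < 1)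
        (_hσres : ∀ z : M, ρ z = z → Valued.v z ≤ 1 → Valued.v (Θ z - z) < 1) (_hres : ∀ z : M, Valued.v z ≤ 1 → Valued.v (z - Θ z) < 1)
        (_hΘne : ∃ x : M, Θ x ≠ x) (_hDM : IsRamifiedQuadraticDatum Θ (jE ϖ) d tE) (_hjiso : ∀ a, Valued.v (jE a) = Valued.v a)
        (_hq : Nat.card 𝓀[M] = Nat.card 𝓀[E] ^ 2) (_hjpow : ∀ (t : E) (n : ℤ), Valued.v (jE t) = Valued.v (jE ϖ) ^ n ↔ Valued.v t = Valued.v ϖ ^ n)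
        (_hEval : ∀ c : M, ρ c = c → c ≠ 0 → Valued.v c ≤ 1 → ∃ n : ℕ, Valued.v c = Valued.v (jE ϖ) ^ n)
        (_hϖmax : ∀ t : M, ρ t = t → Valued.v t < 1 → Valued.v t ≤ Valued.v (jE ϖ))
        (γ₂ : GL (Fin 2) E) (u : GL (Fin 1) E)
        (_hdet : (γ₂ : Matrix (Fin 2) (Fin 2) E).det * σ (γ₂ : Matrix (Fin 2) (Fin 2) E).det = 1)
        (_htr : (γ₂ : Matrix (Fin 2) (Fin 2) E).trace = (γ₂ : Matrix (Fin 2) (Fin 2) E).det * σ (γ₂ : Matrix (Fin 2) (Fin 2) E).trace)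
        (_hirr : ∀ x : E, x * x - (γ₂ : Matrix (Fin 2) (Fin 2) E).trace * x + (γ₂ : Matrix (Fin 2) (Fin 2) E).det ≠ 0)
        (_hlam2 : lam * lam = jE (γ₂ : Matrix (Fin 2) (Fin 2) E).trace * lam - jE (γ₂ : Matrix (Fin 2) (Fin 2) E).det)
        (_hρlam : ρ lam = jE (γ₂ : Matrix (Fin 2) (Fin 2) E).trace - lam) (m jl : ℕ) (_hm : Valued.v (lam - jE ((u : Matrix (Fin 1) (Fin 1) E) 0 0)) = WithZero.exp (-(m : ℤ)))
        (_hjl : Valued.v ((lam - jE ((u : Matrix (Fin 1) (Fin 1) E) 0 0)) - ρ (lam - jE ((u : Matrix (Fin 1) (Fin 1) E) 0 0))) = WithZero.exp (-(jl : ℤ)))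
        (_hs : Valued.v ((γ₂ : Matrix (Fin 2) (Fin 2) E).trace - 2) * Valued.v (ϖ ^ (d % 2)) ≤ Valued.v (ϖ ^ mcOfRecord d))
        (_hp : Valued.v ((γ₂ : Matrix (Fin 2) (Fin 2) E).det - (γ₂ : Matrix (Fin 2) (Fin 2) E).trace + 1) ≤ Valued.v (ϖ ^ mcOfRecord d))
        (_hNm : N d tE (Nat.card 𝓀[E]) ≤ m) (_hu1N : Valued.v (((u : Matrix (Fin 1) (Fin 1) E) 0 0) - 1) ≤ Valued.v (ϖ ^ N d tE (Nat.card 𝓀[E]))) (_hlam1 : Valued.v (lam - 1) ≤ Valued.v (jE ϖ ^ N d tE (Nat.card 𝓀[E])))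
        (_hu : Valued.v ((u : Matrix (Fin 1) (Fin 1) E) 0 0) = 1) (_hum : Valued.v (((u : Matrix (Fin 1) (Fin 1) E) 0 0) - 1) ≤ Valued.v (ϖ ^ mstarOfRecord d))
        (H₂ : Matrix (Fin 2) (Fin 2) E) (hW : E) (_hH₂ : IsUnit H₂.det) (_hH₂σ : (H₂.map σ)ᵀ = H₂) (_hhW : Valued.v hW = 1) (_hhWσ : σ hW = hW)
        (P₁ : GL (Fin 3) E) (_hA : formCongr σ P₁ ((StdForm.antidiagonal 3).over E) = (!![H₂ 0 0, 0, H₂ 0 1; 0, hW, 0; H₂ 1 0, 0, H₂ 1 1] : Matrix (Fin 3) (Fin 3) E))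
        (_hΓ : P₁ * endoGL (γ₂, u) * P₁⁻¹ ∈ unitaryGroupOfForm σ ((StdForm.antidiagonal 3).over E))
        (φ : (Fin 2 → E) →+ M) (h : M) (_hφs : ∀ (c : E) (x : Fin 2 → E), φ (c • x) = jE c * φ x) (_hφi : Function.Injective φ) (_hφo : Function.Surjective φ)
        (_hφγ : ∀ x, φ ((γ₂ : Matrix (Fin 2) (Fin 2) E).mulVec x) = lam * φ x)
        (_hform : ∀ x y, jE (pairing σ H₂ x y) = h * Θ (φ x) * φ y + ρ (h * Θ (φ x) * φ y)) (_hΘh : Θ h = h) (_hh : h ≠ 0)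
        (J R : ℕ) (f : ℕ → ℕ → AddSubgroup M → ℕ)
        (_hfinF : {L₃ : Submodule 𝒪[E] (Fin 3 → E) | IsSelfDualLattice σ ϖ (!![H₂ 0 0, 0, H₂ 0 1; 0, hW, 0; H₂ 1 0, 0, H₂ 1 1] : Matrix (Fin 3) (Fin 3) E) L₃ ∧ mapGL (endoGL (γ₂, u)) L₃ = L₃}.Finite)
        (_hR : ∀ L₃ : Submodule 𝒪[E] (Fin 3 → E), IsSelfDualLattice σ ϖ (!![H₂ 0 0, 0, H₂ 0 1; 0, hW, 0; H₂ 1 0, 0, H₂ 1 1] : Matrix (Fin 3) (Fin 3) E) L₃ →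
          mapGL (endoGL (γ₂, u)) L₃ = L₃ → ∀ b : ℕ, (∀ c : E, (Pi.single 1 c : Fin 3 → E) ∈ L₃ ↔ Valued.v c ≤ Valued.v ϖ ^ b) → b ≤ R)
        (_hJ : ¬ IsOrd ρ α (jE ϖ ^ (J + 1)) lam) (_hfinLS : ∀ j a, (levelSet ρ Θ α (jE ϖ) h j a).Finite)
        (_hf : ∀ (b j : ℕ) (Λ : AddSubgroup M) (x₀ : M) (r : E), 1 ≤ b → x₀ ≠ 0 → (∀ x, x ∈ Λ ↔ ∃ z, IsOrd ρ α (jE ϖ ^ j) z ∧ x = x₀ * z) →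
          IsOrd ρ α (jE ϖ ^ j) (dualGen ρ Θ α (jE ϖ ^ j) h x₀) → ¬ IsOrd ρ α (jE ϖ ^ j) (dualGen ρ Θ α (jE ϖ ^ j) h x₀ / jE ϖ) → Valued.v (dualGen ρ Θ α (jE ϖ ^ j) h x₀) = Valued.v (jE ϖ) ^ b →
          (∀ b', (∀ x ∈ Λ, Valued.v (h * Θ x * b' + ρ (h * Θ x * b')) ≤ 1) → (lam - jE ((u : Matrix (Fin 1) (Fin 1) E) 0 0)) * b' ∈ Λ) → IsOrd ρ α (jE ϖ ^ j) lam →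
          jE r = glueUnit ρ Θ α (jE ϖ ^ j) h (jE ϖ) (jE hW) x₀ b →
          f b j Λ = Nat.card {x : 𝒪[E] ⧸ 𝓂[E] ^ (2 * b) // ∃ u' : 𝒪[E], Ideal.Quotient.mk (𝓂[E] ^ (2 * b)) u' = x ∧ Valued.v ((u' : E) * σ u' - r) ≤ Valued.v (ϖ ^ (2 * b))}),
        (∀ j : ℕ, IsOrd ρ α (jE ϖ ^ j) lam ↔ j ≤ jl) ∧
        (∀ b j : ℕ, 1 ≤ b → 2 * b = m →
          (j < b ∨ (b ≤ j ∧ (j - b) % 2 = 1) ∨ jl < j + b ∨ ((¬ ∃ x : M, x ≠ 0 ∧ h * Θ x * x + ρ (h * Θ x * x) = 0) ∧ b + 2 * d ≤ j ∧ (j - b) % 2 = 0)) →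
                ((∑ᶠ Λ ∈ levelSetDep ρ Θ α (jE ϖ) h j b (lam - jE ((u : Matrix (Fin 1) (Fin 1) E) 0 0)) ∩
                      {Λ | ∃ B : Submodule 𝒪[E] (Fin 2 → E), B.toAddSubgroup.map φ = Λ ∧
                        ∃ L₃ : Submodule 𝒪[E] (Fin 3 → E), IsSelfDualLattice σ ϖ (!![H₂ 0 0, 0, H₂ 0 1; 0, hW, 0; H₂ 1 0, 0, H₂ 1 1] : Matrix (Fin 3) (Fin 3) E) L₃ ∧
                          L₃ ⊓ LinearMap.ker ((LinearMap.proj (1 : Fin 3) : (Fin 3 → E) →ₗ[E] E).restrictScalars 𝒪[E]) =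
                            B.map ((Matrix.toLin' (!![1, 0; 0, 0; 0, 1] : Matrix (Fin 3) (Fin 2) E)).restrictScalars 𝒪[E]) ∧
                          (∀ c : E, (Pi.single 1 c : Fin 3 → E) ∈ L₃ ↔ Valued.v c ≤ Valued.v ϖ ^ b) ∧
                          (LatticeNearTransvShell ϖ (d % 2) (mstarOfRecord d) ((((endoGL (γ₂, u) : GL (Fin 3) E) : Matrix (Fin 3) (Fin 3) E) - 1)) L₃ ∧
                            {z : E | ∃ y ∈ L₃, Valued.v ((ϖ ^ (mstarOfRecord d))⁻¹ * (z - pairing σ (!![H₂ 0 0, 0, H₂ 0 1; 0, hW, 0; H₂ 1 0, 0, H₂ 1 1] : Matrix (Fin 3) (Fin 3) E) y (((((endoGL (γ₂, u) : GL (Fin 3) E) : Matrix (Fin 3) (Fin 3) E) - 1)) *ᵥ y))) ≤ 1} =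
                              valueSetMod σ ϖ (mstarOfRecord d) (xPlus σ ϖ d))}, f b j Λ : ℕ) : ℤ) -
                  ((∑ᶠ Λ ∈ levelSetDep ρ Θ α (jE ϖ) h j b (lam - jE ((u : Matrix (Fin 1) (Fin 1) E) 0 0)) ∩
                      {Λ | ∃ B : Submodule 𝒪[E] (Fin 2 → E), B.toAddSubgroup.map φ = Λ ∧
                        ∃ L₃ : Submodule 𝒪[E] (Fin 3 → E), IsSelfDualLattice σ ϖ (!![H₂ 0 0, 0, H₂ 0 1; 0, hW, 0; H₂ 1 0, 0, H₂ 1 1] : Matrix (Fin 3) (Fin 3) E) L₃ ∧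
                          L₃ ⊓ LinearMap.ker ((LinearMap.proj (1 : Fin 3) : (Fin 3 → E) →ₗ[E] E).restrictScalars 𝒪[E]) =
                            B.map ((Matrix.toLin' (!![1, 0; 0, 0; 0, 1] : Matrix (Fin 3) (Fin 2) E)).restrictScalars 𝒪[E]) ∧
                          (∀ c : E, (Pi.single 1 c : Fin 3 → E) ∈ L₃ ↔ Valued.v c ≤ Valued.v ϖ ^ b) ∧
                          (LatticeNearTransvShell ϖ (d % 2) (mcOfRecord d) ((((endoGL (γ₂, u) : GL (Fin 3) E) : Matrix (Fin 3) (Fin 3) E) - 1)) L₃ ∧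
                            ¬ {z : E | ∃ y ∈ L₃, Valued.v ((ϖ ^ (mstarOfRecord d))⁻¹ * (z - pairing σ (!![H₂ 0 0, 0, H₂ 0 1; 0, hW, 0; H₂ 1 0, 0, H₂ 1 1] : Matrix (Fin 3) (Fin 3) E) y (((((endoGL (γ₂, u) : GL (Fin 3) E) : Matrix (Fin 3) (Fin 3) E) - 1)) *ᵥ y))) ≤ 1} =
                              valueSetMod σ ϖ (mstarOfRecord d) (xPlus σ ϖ d))}, f b j Λ : ℕ) : ℤ) = 0) ∧
        (∀ b j : ℕ, 1 ≤ b → 2 * b = m → IsOrd ρ α (jE ϖ ^ j) lam →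
                ((∑ᶠ Λ ∈ levelSetDep ρ Θ α (jE ϖ) h j b (lam - jE ((u : Matrix (Fin 1) (Fin 1) E) 0 0)) ∩
                      {Λ | ∃ B : Submodule 𝒪[E] (Fin 2 → E), B.toAddSubgroup.map φ = Λ ∧
                        ∃ L₃ : Submodule 𝒪[E] (Fin 3 → E), IsSelfDualLattice σ ϖ (!![H₂ 0 0, 0, H₂ 0 1; 0, hW, 0; H₂ 1 0, 0, H₂ 1 1] : Matrix (Fin 3) (Fin 3) E) L₃ ∧
                          L₃ ⊓ LinearMap.ker ((LinearMap.proj (1 : Fin 3) : (Fin 3 → E) →ₗ[E] E).restrictScalars 𝒪[E]) =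
                            B.map ((Matrix.toLin' (!![1, 0; 0, 0; 0, 1] : Matrix (Fin 3) (Fin 2) E)).restrictScalars 𝒪[E]) ∧
                          (∀ c : E, (Pi.single 1 c : Fin 3 → E) ∈ L₃ ↔ Valued.v c ≤ Valued.v ϖ ^ b) ∧
                          (LatticeNearTransvShell ϖ (d % 2) (mstarOfRecord d) ((((endoGL (γ₂, u) : GL (Fin 3) E) : Matrix (Fin 3) (Fin 3) E) - 1)) L₃ ∧
                            {z : E | ∃ y ∈ L₃, Valued.v ((ϖ ^ (mstarOfRecord d))⁻¹ * (z - pairing σ (!![H₂ 0 0, 0, H₂ 0 1; 0, hW, 0; H₂ 1 0, 0, H₂ 1 1] : Matrix (Fin 3) (Fin 3) E) y (((((endoGL (γ₂, u) : GL (Fin 3) E) : Matrix (Fin 3) (Fin 3) E) - 1)) *ᵥ y))) ≤ 1} =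
                              valueSetMod σ ϖ (mstarOfRecord d) (xPlus σ ϖ d))}, f b j Λ : ℕ) : ℤ) -
                  ((∑ᶠ Λ ∈ levelSetDep ρ Θ α (jE ϖ) h j b (lam - jE ((u : Matrix (Fin 1) (Fin 1) E) 0 0)) ∩
                      {Λ | ∃ B : Submodule 𝒪[E] (Fin 2 → E), B.toAddSubgroup.map φ = Λ ∧
                        ∃ L₃ : Submodule 𝒪[E] (Fin 3 → E), IsSelfDualLattice σ ϖ (!![H₂ 0 0, 0, H₂ 0 1; 0, hW, 0; H₂ 1 0, 0, H₂ 1 1] : Matrix (Fin 3) (Fin 3) E) L₃ ∧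
                          L₃ ⊓ LinearMap.ker ((LinearMap.proj (1 : Fin 3) : (Fin 3 → E) →ₗ[E] E).restrictScalars 𝒪[E]) =
                            B.map ((Matrix.toLin' (!![1, 0; 0, 0; 0, 1] : Matrix (Fin 3) (Fin 2) E)).restrictScalars 𝒪[E]) ∧
                          (∀ c : E, (Pi.single 1 c : Fin 3 → E) ∈ L₃ ↔ Valued.v c ≤ Valued.v ϖ ^ b) ∧
                          (LatticeNearTransvShell ϖ (d % 2) (mcOfRecord d) ((((endoGL (γ₂, u) : GL (Fin 3) E) : Matrix (Fin 3) (Fin 3) E) - 1)) L₃ ∧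
                            ¬ {z : E | ∃ y ∈ L₃, Valued.v ((ϖ ^ (mstarOfRecord d))⁻¹ * (z - pairing σ (!![H₂ 0 0, 0, H₂ 0 1; 0, hW, 0; H₂ 1 0, 0, H₂ 1 1] : Matrix (Fin 3) (Fin 3) E) y (((((endoGL (γ₂, u) : GL (Fin 3) E) : Matrix (Fin 3) (Fin 3) E) - 1)) *ᵥ y))) ≤ 1} =
                              valueSetMod σ ϖ (mstarOfRecord d) (xPlus σ ϖ d))}, f b j Λ : ℕ) : ℤ) ≠ 0 → b ≤ R))
    (hcore :
      ∀ (E M : Type) [Field E] [Valued E ℤᵐ⁰] [CompleteSpace E] [IsDiscreteValuationRing 𝒪[E]] [Finite 𝓀[E]]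
        [Field M] [Valued M ℤᵐ⁰] [CompleteSpace M] [IsDiscreteValuationRing 𝒪[M]] [Finite 𝓀[M]]
        (σ : E →+* E) (ϖ : E) (d tE : ℕ) (_hD : IsRamifiedQuadraticDatum σ ϖ d tE) (_hσσ : ∀ a, σ (σ a) = a) (_h2 : ¬ IsUnit (2 : 𝒪[E]))
        (jE : E →+* M) (ρ Θ : M →+* M) (α lam : M)
        (_hρρ : ∀ z, ρ (ρ z) = z) (_hvρ : ∀ z, Valued.v (ρ z) = Valued.v z) (_hρj : ∀ a, ρ (jE a) = jE a)
        (_hjv : ∀ a, Valued.v (jE a) ≤ 1 ↔ Valued.v a ≤ 1) (_hjfix : ∀ z : M, ρ z = z ↔ ∃ a, jE a = z) (_hΘj : ∀ a, Θ (jE a) = jE (σ a))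
        (_hΘΘ : ∀ z, Θ (Θ z) = z) (_hΘρ : ∀ z, Θ (ρ z) = ρ (Θ z)) (_hvΘ : ∀ z, Valued.v (Θ z) = Valued.v z)
        (_hα : ρ α ≠ α) (_hα1 : Valued.v α ≤ 1) (_hint : ∀ z : M, Valued.v z ≤ 1 → Valued.v ((z - ρ z) / (α - ρ α)) ≤ 1)
        (_hΘlam : Θ lam * lam = 1) (_hvlam : Valued.v lam = 1) (_hbasis : ∀ z : M, ∃! pq : E × E, z = jE pq.1 + jE pq.2 * lam)
        (_hU : Valued.v (α - ρ α) = 1) (_hτ : Valued.v (α - Θ α) < 1)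
        (_hσres : ∀ z : M, ρ z = z → Valued.v z ≤ 1 → Valued.v (Θ z - z) < 1) (_hres : ∀ z : M, Valued.v z ≤ 1 → Valued.v (z - Θ z) < 1)
        (_hΘne : ∃ x : M, Θ x ≠ x) (_hDM : IsRamifiedQuadraticDatum Θ (jE ϖ) d tE) (_hjiso : ∀ a, Valued.v (jE a) = Valued.v a)
        (_hq : Nat.card 𝓀[M] = Nat.card 𝓀[E] ^ 2) (_hjpow : ∀ (t : E) (n : ℤ), Valued.v (jE t) = Valued.v (jE ϖ) ^ n ↔ Valued.v t = Valued.v ϖ ^ n)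
        (_hEval : ∀ c : M, ρ c = c → c ≠ 0 → Valued.v c ≤ 1 → ∃ n : ℕ, Valued.v c = Valued.v (jE ϖ) ^ n)
        (_hϖmax : ∀ t : M, ρ t = t → Valued.v t < 1 → Valued.v t ≤ Valued.v (jE ϖ))
        (γ₂ : GL (Fin 2) E) (u : GL (Fin 1) E)
        (_hdet : (γ₂ : Matrix (Fin 2) (Fin 2) E).det * σ (γ₂ : Matrix (Fin 2) (Fin 2) E).det = 1)
        (_htr : (γ₂ : Matrix (Fin 2) (Fin 2) E).trace = (γ₂ : Matrix (Fin 2) (Fin 2) E).det * σ (γ₂ : Matrix (Fin 2) (Fin 2) E).trace)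
        (_hirr : ∀ x : E, x * x - (γ₂ : Matrix (Fin 2) (Fin 2) E).trace * x + (γ₂ : Matrix (Fin 2) (Fin 2) E).det ≠ 0)
        (_hlam2 : lam * lam = jE (γ₂ : Matrix (Fin 2) (Fin 2) E).trace * lam - jE (γ₂ : Matrix (Fin 2) (Fin 2) E).det)
        (_hρlam : ρ lam = jE (γ₂ : Matrix (Fin 2) (Fin 2) E).trace - lam) (m jl : ℕ) (_hm : Valued.v (lam - jE ((u : Matrix (Fin 1) (Fin 1) E) 0 0)) = WithZero.exp (-(m : ℤ)))
        (_hjl : Valued.v ((lam - jE ((u : Matrix (Fin 1) (Fin 1) E) 0 0)) - ρ (lam - jE ((u : Matrix (Fin 1) (Fin 1) E) 0 0))) = WithZero.exp (-(jl : ℤ)))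
        (_hs : Valued.v ((γ₂ : Matrix (Fin 2) (Fin 2) E).trace - 2) * Valued.v (ϖ ^ (d % 2)) ≤ Valued.v (ϖ ^ mcOfRecord d))
        (_hp : Valued.v ((γ₂ : Matrix (Fin 2) (Fin 2) E).det - (γ₂ : Matrix (Fin 2) (Fin 2) E).trace + 1) ≤ Valued.v (ϖ ^ mcOfRecord d))
        (_hNm : N d tE (Nat.card 𝓀[E]) ≤ m) (_hu1N : Valued.v (((u : Matrix (Fin 1) (Fin 1) E) 0 0) - 1) ≤ Valued.v (ϖ ^ N d tE (Nat.card 𝓀[E]))) (_hlam1 : Valued.v (lam - 1) ≤ Valued.v (jE ϖ ^ N d tE (Nat.card 𝓀[E])))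
        (_hu : Valued.v ((u : Matrix (Fin 1) (Fin 1) E) 0 0) = 1) (_hum : Valued.v (((u : Matrix (Fin 1) (Fin 1) E) 0 0) - 1) ≤ Valued.v (ϖ ^ mstarOfRecord d))
        (_hg1 : ∀ i j, Valued.v ((γ₂ : Matrix (Fin 2) (Fin 2) E) i j - (1 : Matrix (Fin 2) (Fin 2) E) i j) ≤ Valued.v (ϖ ^ N d tE (Nat.card 𝓀[E]))) (P₁ : GL (Fin 3) E) (dg : Fin 2 → E) (η : E) (γ₁ : GL (Fin 2) E)
        (_hΓ : endoGL (γ₂, u) ∈ unitaryGroupOfForm σ ((StdForm.antidiagonal 3).over E))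
        (_hΓ' : P₁ * endoGL (γ₁, u) * P₁⁻¹ ∈ unitaryGroupOfForm σ ((StdForm.antidiagonal 3).over E))
        (_hA : formCongr σ P₁ ((StdForm.antidiagonal 3).over E) = (!![(Matrix.diagonal dg) 0 0, 0, (Matrix.diagonal dg) 0 1; 0, η, 0; (Matrix.diagonal dg) 1 0, 0, (Matrix.diagonal dg) 1 1] : Matrix (Fin 3) (Fin 3) E))
        (_hdg1 : ∀ i, Valued.v (dg i) = 1) (_hdgσ : ∀ i, σ (dg i) = dg i) (_hησ : σ η = η) (_hη1 : Valued.v η = 1) (_hηN : ¬ ∃ t : E, t * σ t = η)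
        (_hγ₁ : γ₁ ∈ unitaryGroupOfForm σ (Matrix.diagonal dg)) (_hA12 : (γ₁ : Matrix (Fin 2) (Fin 2) E).charpoly = (γ₂ : Matrix (Fin 2) (Fin 2) E).charpoly)
        (φ : (Fin 2 → E) →+ M) (h : M) (φ' : (Fin 2 → E) →+ M) (h' : M) (_hφs : ∀ (c : E) (x : Fin 2 → E), φ (c • x) = jE c * φ x) (_hφi : Function.Injective φ) (_hφo : Function.Surjective φ)
        (_hφγ : ∀ x, φ ((γ₂ : Matrix (Fin 2) (Fin 2) E).mulVec x) = lam * φ x)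
        (_hform : ∀ x y, jE (pairing σ ((StdForm.antidiagonal 2).over E) x y) = h * Θ (φ x) * φ y + ρ (h * Θ (φ x) * φ y)) (_hΘh : Θ h = h) (_hh : h ≠ 0)
        (_hhyper : ∃ x : M, x ≠ 0 ∧ h * Θ x * x + ρ (h * Θ x * x) = 0)
        (_hφ's : ∀ (c : E) (x : Fin 2 → E), φ' (c • x) = jE c * φ' x) (_hφ'i : Function.Injective φ') (_hφ'o : Function.Surjective φ')
        (_hφ'γ : ∀ x, φ' ((γ₁ : Matrix (Fin 2) (Fin 2) E).mulVec x) = lam * φ' x)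
        (_hform' : ∀ x y, jE (pairing σ (Matrix.diagonal dg) x y) = h' * Θ (φ' x) * φ' y + ρ (h' * Θ (φ' x) * φ' y)) (_hΘh' : Θ h' = h') (_hh' : h' ≠ 0)
        (J R R' : ℕ) (f f' : ℕ → ℕ → AddSubgroup M → ℕ)
        (_hfinF : {L₃ : Submodule 𝒪[E] (Fin 3 → E) | IsSelfDualLattice σ ϖ (!![((StdForm.antidiagonal 2).over E) 0 0, 0, ((StdForm.antidiagonal 2).over E) 0 1; 0, (1 : E), 0; ((StdForm.antidiagonal 2).over E) 1 0, 0, ((StdForm.antidiagonal 2).over E) 1 1] : Matrix (Fin 3) (Fin 3) E) L₃ ∧ mapGL (endoGL (γ₂, u)) L₃ = L₃}.Finite)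
        (_hR : ∀ L₃ : Submodule 𝒪[E] (Fin 3 → E), IsSelfDualLattice σ ϖ (!![((StdForm.antidiagonal 2).over E) 0 0, 0, ((StdForm.antidiagonal 2).over E) 0 1; 0, (1 : E), 0; ((StdForm.antidiagonal 2).over E) 1 0, 0, ((StdForm.antidiagonal 2).over E) 1 1] : Matrix (Fin 3) (Fin 3) E) L₃ →
          mapGL (endoGL (γ₂, u)) L₃ = L₃ → ∀ b : ℕ, (∀ c : E, (Pi.single 1 c : Fin 3 → E) ∈ L₃ ↔ Valued.v c ≤ Valued.v ϖ ^ b) → b ≤ R)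
        (_hfinF' : {L₃ : Submodule 𝒪[E] (Fin 3 → E) | IsSelfDualLattice σ ϖ (!![(Matrix.diagonal dg) 0 0, 0, (Matrix.diagonal dg) 0 1; 0, η, 0; (Matrix.diagonal dg) 1 0, 0, (Matrix.diagonal dg) 1 1] : Matrix (Fin 3) (Fin 3) E) L₃ ∧ mapGL (endoGL (γ₁, u)) L₃ = L₃}.Finite)
        (_hR' : ∀ L₃ : Submodule 𝒪[E] (Fin 3 → E), IsSelfDualLattice σ ϖ (!![(Matrix.diagonal dg) 0 0, 0, (Matrix.diagonal dg) 0 1; 0, η, 0; (Matrix.diagonal dg) 1 0, 0, (Matrix.diagonal dg) 1 1] : Matrix (Fin 3) (Fin 3) E) L₃ →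
          mapGL (endoGL (γ₁, u)) L₃ = L₃ → ∀ b : ℕ, (∀ c : E, (Pi.single 1 c : Fin 3 → E) ∈ L₃ ↔ Valued.v c ≤ Valued.v ϖ ^ b) → b ≤ R')
        (_hJ : ¬ IsOrd ρ α (jE ϖ ^ (J + 1)) lam) (_hfinLS : ∀ j a, (levelSet ρ Θ α (jE ϖ) h j a).Finite) (_hfinLS' : ∀ j a, (levelSet ρ Θ α (jE ϖ) h' j a).Finite)
        (_hf : ∀ (b j : ℕ) (Λ : AddSubgroup M) (x₀ : M) (r : E), 1 ≤ b → x₀ ≠ 0 → (∀ x, x ∈ Λ ↔ ∃ z, IsOrd ρ α (jE ϖ ^ j) z ∧ x = x₀ * z) →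
          IsOrd ρ α (jE ϖ ^ j) (dualGen ρ Θ α (jE ϖ ^ j) h x₀) → ¬ IsOrd ρ α (jE ϖ ^ j) (dualGen ρ Θ α (jE ϖ ^ j) h x₀ / jE ϖ) → Valued.v (dualGen ρ Θ α (jE ϖ ^ j) h x₀) = Valued.v (jE ϖ) ^ b →
          (∀ b', (∀ x ∈ Λ, Valued.v (h * Θ x * b' + ρ (h * Θ x * b')) ≤ 1) → (lam - jE ((u : Matrix (Fin 1) (Fin 1) E) 0 0)) * b' ∈ Λ) → IsOrd ρ α (jE ϖ ^ j) lam →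
          jE r = glueUnit ρ Θ α (jE ϖ ^ j) h (jE ϖ) (jE 1) x₀ b →
          f b j Λ = Nat.card {x : 𝒪[E] ⧸ 𝓂[E] ^ (2 * b) // ∃ u' : 𝒪[E], Ideal.Quotient.mk (𝓂[E] ^ (2 * b)) u' = x ∧ Valued.v ((u' : E) * σ u' - r) ≤ Valued.v (ϖ ^ (2 * b))})
        (_hf' : ∀ (b j : ℕ) (Λ : AddSubgroup M) (x₀ : M) (r : E), 1 ≤ b → x₀ ≠ 0 → (∀ x, x ∈ Λ ↔ ∃ z, IsOrd ρ α (jE ϖ ^ j) z ∧ x = x₀ * z) →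
          IsOrd ρ α (jE ϖ ^ j) (dualGen ρ Θ α (jE ϖ ^ j) h' x₀) → ¬ IsOrd ρ α (jE ϖ ^ j) (dualGen ρ Θ α (jE ϖ ^ j) h' x₀ / jE ϖ) → Valued.v (dualGen ρ Θ α (jE ϖ ^ j) h' x₀) = Valued.v (jE ϖ) ^ b →
          (∀ b', (∀ x ∈ Λ, Valued.v (h' * Θ x * b' + ρ (h' * Θ x * b')) ≤ 1) → (lam - jE ((u : Matrix (Fin 1) (Fin 1) E) 0 0)) * b' ∈ Λ) → IsOrd ρ α (jE ϖ ^ j) lam →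
          jE r = glueUnit ρ Θ α (jE ϖ ^ j) h' (jE ϖ) (jE η) x₀ b →
          f' b j Λ = Nat.card {x : 𝒪[E] ⧸ 𝓂[E] ^ (2 * b) // ∃ u' : 𝒪[E], Ideal.Quotient.mk (𝓂[E] ^ (2 * b)) u' = x ∧ Valued.v ((u' : E) * σ u' - r) ≤ Valued.v (ϖ ^ (2 * b))}),
        ∀ b : ℕ, 1 ≤ b → 2 * b = m → (¬ ∃ x : M, x ≠ 0 ∧ h' * Θ x * x + ρ (h' * Θ x * x) = 0) →
          ∑ i ∈ Finset.range ((jl - m) / 2 + 1),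
            (((∑ᶠ Λ ∈ levelSetDep ρ Θ α (jE ϖ) h (b + 2 * i) b (lam - jE ((u : Matrix (Fin 1) (Fin 1) E) 0 0)) ∩
                      {Λ | ∃ B : Submodule 𝒪[E] (Fin 2 → E), B.toAddSubgroup.map φ = Λ ∧
                        ∃ L₃ : Submodule 𝒪[E] (Fin 3 → E), IsSelfDualLattice σ ϖ (!![((StdForm.antidiagonal 2).over E) 0 0, 0, ((StdForm.antidiagonal 2).over E) 0 1; 0, (1 : E), 0; ((StdForm.antidiagonal 2).over E) 1 0, 0, ((StdForm.antidiagonal 2).over E) 1 1] : Matrix (Fin 3) (Fin 3) E) L₃ ∧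
                          L₃ ⊓ LinearMap.ker ((LinearMap.proj (1 : Fin 3) : (Fin 3 → E) →ₗ[E] E).restrictScalars 𝒪[E]) =
                            B.map ((Matrix.toLin' (!![1, 0; 0, 0; 0, 1] : Matrix (Fin 3) (Fin 2) E)).restrictScalars 𝒪[E]) ∧
                          (∀ c : E, (Pi.single 1 c : Fin 3 → E) ∈ L₃ ↔ Valued.v c ≤ Valued.v ϖ ^ b) ∧
                          (LatticeNearTransvShell ϖ (d % 2) (mstarOfRecord d) ((((endoGL (γ₂, u) : GL (Fin 3) E) : Matrix (Fin 3) (Fin 3) E) - 1)) L₃ ∧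
                            {z : E | ∃ y ∈ L₃, Valued.v ((ϖ ^ (mstarOfRecord d))⁻¹ * (z - pairing σ (!![((StdForm.antidiagonal 2).over E) 0 0, 0, ((StdForm.antidiagonal 2).over E) 0 1; 0, (1 : E), 0; ((StdForm.antidiagonal 2).over E) 1 0, 0, ((StdForm.antidiagonal 2).over E) 1 1] : Matrix (Fin 3) (Fin 3) E) y (((((endoGL (γ₂, u) : GL (Fin 3) E) : Matrix (Fin 3) (Fin 3) E) - 1)) *ᵥ y))) ≤ 1} =
                              valueSetMod σ ϖ (mstarOfRecord d) (xPlus σ ϖ d))}, f b (b + 2 * i) Λ : ℕ) : ℤ) -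
                  ((∑ᶠ Λ ∈ levelSetDep ρ Θ α (jE ϖ) h (b + 2 * i) b (lam - jE ((u : Matrix (Fin 1) (Fin 1) E) 0 0)) ∩
                      {Λ | ∃ B : Submodule 𝒪[E] (Fin 2 → E), B.toAddSubgroup.map φ = Λ ∧
                        ∃ L₃ : Submodule 𝒪[E] (Fin 3 → E), IsSelfDualLattice σ ϖ (!![((StdForm.antidiagonal 2).over E) 0 0, 0, ((StdForm.antidiagonal 2).over E) 0 1; 0, (1 : E), 0; ((StdForm.antidiagonal 2).over E) 1 0, 0, ((StdForm.antidiagonal 2).over E) 1 1] : Matrix (Fin 3) (Fin 3) E) L₃ ∧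
                          L₃ ⊓ LinearMap.ker ((LinearMap.proj (1 : Fin 3) : (Fin 3 → E) →ₗ[E] E).restrictScalars 𝒪[E]) =
                            B.map ((Matrix.toLin' (!![1, 0; 0, 0; 0, 1] : Matrix (Fin 3) (Fin 2) E)).restrictScalars 𝒪[E]) ∧
                          (∀ c : E, (Pi.single 1 c : Fin 3 → E) ∈ L₃ ↔ Valued.v c ≤ Valued.v ϖ ^ b) ∧
                          (LatticeNearTransvShell ϖ (d % 2) (mcOfRecord d) ((((endoGL (γ₂, u) : GL (Fin 3) E) : Matrix (Fin 3) (Fin 3) E) - 1)) L₃ ∧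
                            ¬ {z : E | ∃ y ∈ L₃, Valued.v ((ϖ ^ (mstarOfRecord d))⁻¹ * (z - pairing σ (!![((StdForm.antidiagonal 2).over E) 0 0, 0, ((StdForm.antidiagonal 2).over E) 0 1; 0, (1 : E), 0; ((StdForm.antidiagonal 2).over E) 1 0, 0, ((StdForm.antidiagonal 2).over E) 1 1] : Matrix (Fin 3) (Fin 3) E) y (((((endoGL (γ₂, u) : GL (Fin 3) E) : Matrix (Fin 3) (Fin 3) E) - 1)) *ᵥ y))) ≤ 1} =
                              valueSetMod σ ϖ (mstarOfRecord d) (xPlus σ ϖ d))}, f b (b + 2 * i) Λ : ℕ) : ℤ)) =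
          ∑ i ∈ Finset.range (min ((jl - m) / 2 + 1) d),
            (((∑ᶠ Λ ∈ levelSetDep ρ Θ α (jE ϖ) h' (b + 2 * i) b (lam - jE ((u : Matrix (Fin 1) (Fin 1) E) 0 0)) ∩
                      {Λ | ∃ B : Submodule 𝒪[E] (Fin 2 → E), B.toAddSubgroup.map φ' = Λ ∧
                        ∃ L₃ : Submodule 𝒪[E] (Fin 3 → E), IsSelfDualLattice σ ϖ (!![(Matrix.diagonal dg) 0 0, 0, (Matrix.diagonal dg) 0 1; 0, η, 0; (Matrix.diagonal dg) 1 0, 0, (Matrix.diagonal dg) 1 1] : Matrix (Fin 3) (Fin 3) E) L₃ ∧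
                          L₃ ⊓ LinearMap.ker ((LinearMap.proj (1 : Fin 3) : (Fin 3 → E) →ₗ[E] E).restrictScalars 𝒪[E]) =
                            B.map ((Matrix.toLin' (!![1, 0; 0, 0; 0, 1] : Matrix (Fin 3) (Fin 2) E)).restrictScalars 𝒪[E]) ∧
                          (∀ c : E, (Pi.single 1 c : Fin 3 → E) ∈ L₃ ↔ Valued.v c ≤ Valued.v ϖ ^ b) ∧
                          (LatticeNearTransvShell ϖ (d % 2) (mstarOfRecord d) ((((endoGL (γ₁, u) : GL (Fin 3) E) : Matrix (Fin 3) (Fin 3) E) - 1)) L₃ ∧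
                            {z : E | ∃ y ∈ L₃, Valued.v ((ϖ ^ (mstarOfRecord d))⁻¹ * (z - pairing σ (!![(Matrix.diagonal dg) 0 0, 0, (Matrix.diagonal dg) 0 1; 0, η, 0; (Matrix.diagonal dg) 1 0, 0, (Matrix.diagonal dg) 1 1] : Matrix (Fin 3) (Fin 3) E) y (((((endoGL (γ₁, u) : GL (Fin 3) E) : Matrix (Fin 3) (Fin 3) E) - 1)) *ᵥ y))) ≤ 1} =
                              valueSetMod σ ϖ (mstarOfRecord d) (xPlus σ ϖ d))}, f' b (b + 2 * i) Λ : ℕ) : ℤ) -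
                  ((∑ᶠ Λ ∈ levelSetDep ρ Θ α (jE ϖ) h' (b + 2 * i) b (lam - jE ((u : Matrix (Fin 1) (Fin 1) E) 0 0)) ∩
                      {Λ | ∃ B : Submodule 𝒪[E] (Fin 2 → E), B.toAddSubgroup.map φ' = Λ ∧
                        ∃ L₃ : Submodule 𝒪[E] (Fin 3 → E), IsSelfDualLattice σ ϖ (!![(Matrix.diagonal dg) 0 0, 0, (Matrix.diagonal dg) 0 1; 0, η, 0; (Matrix.diagonal dg) 1 0, 0, (Matrix.diagonal dg) 1 1] : Matrix (Fin 3) (Fin 3) E) L₃ ∧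
                          L₃ ⊓ LinearMap.ker ((LinearMap.proj (1 : Fin 3) : (Fin 3 → E) →ₗ[E] E).restrictScalars 𝒪[E]) =
                            B.map ((Matrix.toLin' (!![1, 0; 0, 0; 0, 1] : Matrix (Fin 3) (Fin 2) E)).restrictScalars 𝒪[E]) ∧
                          (∀ c : E, (Pi.single 1 c : Fin 3 → E) ∈ L₃ ↔ Valued.v c ≤ Valued.v ϖ ^ b) ∧
                          (LatticeNearTransvShell ϖ (d % 2) (mcOfRecord d) ((((endoGL (γ₁, u) : GL (Fin 3) E) : Matrix (Fin 3) (Fin 3) E) - 1)) L₃ ∧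
                            ¬ {z : E | ∃ y ∈ L₃, Valued.v ((ϖ ^ (mstarOfRecord d))⁻¹ * (z - pairing σ (!![(Matrix.diagonal dg) 0 0, 0, (Matrix.diagonal dg) 0 1; 0, η, 0; (Matrix.diagonal dg) 1 0, 0, (Matrix.diagonal dg) 1 1] : Matrix (Fin 3) (Fin 3) E) y (((((endoGL (γ₁, u) : GL (Fin 3) E) : Matrix (Fin 3) (Fin 3) E) - 1)) *ᵥ y))) ≤ 1} =
                              valueSetMod σ ϖ (mstarOfRecord d) (xPlus σ ϖ d))}, f' b (b + 2 * i) Λ : ℕ) : ℤ))) :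
      ∀ (E M : Type) [Field E] [Valued E ℤᵐ⁰] [CompleteSpace E] [IsDiscreteValuationRing 𝒪[E]] [Finite 𝓀[E]]
        [Field M] [Valued M ℤᵐ⁰] [CompleteSpace M] [IsDiscreteValuationRing 𝒪[M]] [Finite 𝓀[M]]
        (σ : E →+* E) (ϖ : E) (d tE : ℕ) (_hD : IsRamifiedQuadraticDatum σ ϖ d tE) (_hσσ : ∀ a, σ (σ a) = a) (_h2 : ¬ IsUnit (2 : 𝒪[E]))
        (jE : E →+* M) (ρ Θ : M →+* M) (α lam : M)
        (_hρρ : ∀ z, ρ (ρ z) = z) (_hvρ : ∀ z, Valued.v (ρ z) = Valued.v z) (_hρj : ∀ a, ρ (jE a) = jE a)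
        (_hjv : ∀ a, Valued.v (jE a) ≤ 1 ↔ Valued.v a ≤ 1) (_hjfix : ∀ z : M, ρ z = z ↔ ∃ a, jE a = z) (_hΘj : ∀ a, Θ (jE a) = jE (σ a))
        (_hΘΘ : ∀ z, Θ (Θ z) = z) (_hΘρ : ∀ z, Θ (ρ z) = ρ (Θ z)) (_hvΘ : ∀ z, Valued.v (Θ z) = Valued.v z)
        (_hα : ρ α ≠ α) (_hα1 : Valued.v α ≤ 1) (_hint : ∀ z : M, Valued.v z ≤ 1 → Valued.v ((z - ρ z) / (α - ρ α)) ≤ 1)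
        (_hΘlam : Θ lam * lam = 1) (_hvlam : Valued.v lam = 1) (_hbasis : ∀ z : M, ∃! pq : E × E, z = jE pq.1 + jE pq.2 * lam)
        (_hU : Valued.v (α - ρ α) = 1) (_hτ : Valued.v (α - Θ α) < 1)
        (_hσres : ∀ z : M, ρ z = z → Valued.v z ≤ 1 → Valued.v (Θ z - z) < 1) (_hres : ∀ z : M, Valued.v z ≤ 1 → Valued.v (z - Θ z) < 1)
        (_hΘne : ∃ x : M, Θ x ≠ x) (_hDM : IsRamifiedQuadraticDatum Θ (jE ϖ) d tE) (_hjiso : ∀ a, Valued.v (jE a) = Valued.v a)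
        (_hq : Nat.card 𝓀[M] = Nat.card 𝓀[E] ^ 2) (_hjpow : ∀ (t : E) (n : ℤ), Valued.v (jE t) = Valued.v (jE ϖ) ^ n ↔ Valued.v t = Valued.v ϖ ^ n)
        (_hEval : ∀ c : M, ρ c = c → c ≠ 0 → Valued.v c ≤ 1 → ∃ n : ℕ, Valued.v c = Valued.v (jE ϖ) ^ n)
        (_hϖmax : ∀ t : M, ρ t = t → Valued.v t < 1 → Valued.v t ≤ Valued.v (jE ϖ))
        (γ₂ : GL (Fin 2) E) (u : GL (Fin 1) E)
        (_hdet : (γ₂ : Matrix (Fin 2) (Fin 2) E).det * σ (γ₂ : Matrix (Fin 2) (Fin 2) E).det = 1)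
        (_htr : (γ₂ : Matrix (Fin 2) (Fin 2) E).trace = (γ₂ : Matrix (Fin 2) (Fin 2) E).det * σ (γ₂ : Matrix (Fin 2) (Fin 2) E).trace)
        (_hirr : ∀ x : E, x * x - (γ₂ : Matrix (Fin 2) (Fin 2) E).trace * x + (γ₂ : Matrix (Fin 2) (Fin 2) E).det ≠ 0)
        (_hlam2 : lam * lam = jE (γ₂ : Matrix (Fin 2) (Fin 2) E).trace * lam - jE (γ₂ : Matrix (Fin 2) (Fin 2) E).det)
        (_hρlam : ρ lam = jE (γ₂ : Matrix (Fin 2) (Fin 2) E).trace - lam) (m jl : ℕ) (_hm : Valued.v (lam - jE ((u : Matrix (Fin 1) (Fin 1) E) 0 0)) = WithZero.exp (-(m : ℤ)))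
        (_hjl : Valued.v ((lam - jE ((u : Matrix (Fin 1) (Fin 1) E) 0 0)) - ρ (lam - jE ((u : Matrix (Fin 1) (Fin 1) E) 0 0))) = WithZero.exp (-(jl : ℤ)))
        (_hs : Valued.v ((γ₂ : Matrix (Fin 2) (Fin 2) E).trace - 2) * Valued.v (ϖ ^ (d % 2)) ≤ Valued.v (ϖ ^ mcOfRecord d))
        (_hp : Valued.v ((γ₂ : Matrix (Fin 2) (Fin 2) E).det - (γ₂ : Matrix (Fin 2) (Fin 2) E).trace + 1) ≤ Valued.v (ϖ ^ mcOfRecord d))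
        (_hNm : N d tE (Nat.card 𝓀[E]) ≤ m) (_hu1N : Valued.v (((u : Matrix (Fin 1) (Fin 1) E) 0 0) - 1) ≤ Valued.v (ϖ ^ N d tE (Nat.card 𝓀[E]))) (_hlam1 : Valued.v (lam - 1) ≤ Valued.v (jE ϖ ^ N d tE (Nat.card 𝓀[E])))
        (_hu : Valued.v ((u : Matrix (Fin 1) (Fin 1) E) 0 0) = 1) (_hum : Valued.v (((u : Matrix (Fin 1) (Fin 1) E) 0 0) - 1) ≤ Valued.v (ϖ ^ mstarOfRecord d))
        (_hg1 : ∀ i j, Valued.v ((γ₂ : Matrix (Fin 2) (Fin 2) E) i j - (1 : Matrix (Fin 2) (Fin 2) E) i j) ≤ Valued.v (ϖ ^ N d tE (Nat.card 𝓀[E]))) (P₁ : GL (Fin 3) E) (dg : Fin 2 → E) (η : E) (γ₁ : GL (Fin 2) E)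
        (_hΓ : endoGL (γ₂, u) ∈ unitaryGroupOfForm σ ((StdForm.antidiagonal 3).over E))
        (_hΓ' : P₁ * endoGL (γ₁, u) * P₁⁻¹ ∈ unitaryGroupOfForm σ ((StdForm.antidiagonal 3).over E))
        (_hA : formCongr σ P₁ ((StdForm.antidiagonal 3).over E) = (!![(Matrix.diagonal dg) 0 0, 0, (Matrix.diagonal dg) 0 1; 0, η, 0; (Matrix.diagonal dg) 1 0, 0, (Matrix.diagonal dg) 1 1] : Matrix (Fin 3) (Fin 3) E))
        (_hdg1 : ∀ i, Valued.v (dg i) = 1) (_hdgσ : ∀ i, σ (dg i) = dg i) (_hησ : σ η = η) (_hη1 : Valued.v η = 1) (_hηN : ¬ ∃ t : E, t * σ t = η)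
        (_hγ₁ : γ₁ ∈ unitaryGroupOfForm σ (Matrix.diagonal dg)) (_hA12 : (γ₁ : Matrix (Fin 2) (Fin 2) E).charpoly = (γ₂ : Matrix (Fin 2) (Fin 2) E).charpoly)
        (φ : (Fin 2 → E) →+ M) (h : M) (φ' : (Fin 2 → E) →+ M) (h' : M) (_hφs : ∀ (c : E) (x : Fin 2 → E), φ (c • x) = jE c * φ x) (_hφi : Function.Injective φ) (_hφo : Function.Surjective φ)
        (_hφγ : ∀ x, φ ((γ₂ : Matrix (Fin 2) (Fin 2) E).mulVec x) = lam * φ x)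
        (_hform : ∀ x y, jE (pairing σ ((StdForm.antidiagonal 2).over E) x y) = h * Θ (φ x) * φ y + ρ (h * Θ (φ x) * φ y)) (_hΘh : Θ h = h) (_hh : h ≠ 0)
        (_hhyper : ∃ x : M, x ≠ 0 ∧ h * Θ x * x + ρ (h * Θ x * x) = 0)
        (_hφ's : ∀ (c : E) (x : Fin 2 → E), φ' (c • x) = jE c * φ' x) (_hφ'i : Function.Injective φ') (_hφ'o : Function.Surjective φ')
        (_hφ'γ : ∀ x, φ' ((γ₁ : Matrix (Fin 2) (Fin 2) E).mulVec x) = lam * φ' x)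
        (_hform' : ∀ x y, jE (pairing σ (Matrix.diagonal dg) x y) = h' * Θ (φ' x) * φ' y + ρ (h' * Θ (φ' x) * φ' y)) (_hΘh' : Θ h' = h') (_hh' : h' ≠ 0)
        (J R R' : ℕ) (f f' : ℕ → ℕ → AddSubgroup M → ℕ)
        (_hfinF : {L₃ : Submodule 𝒪[E] (Fin 3 → E) | IsSelfDualLattice σ ϖ (!![((StdForm.antidiagonal 2).over E) 0 0, 0, ((StdForm.antidiagonal 2).over E) 0 1; 0, (1 : E), 0; ((StdForm.antidiagonal 2).over E) 1 0, 0, ((StdForm.antidiagonal 2).over E) 1 1] : Matrix (Fin 3) (Fin 3) E) L₃ ∧ mapGL (endoGL (γ₂, u)) L₃ = L₃}.Finite)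
        (_hR : ∀ L₃ : Submodule 𝒪[E] (Fin 3 → E), IsSelfDualLattice σ ϖ (!![((StdForm.antidiagonal 2).over E) 0 0, 0, ((StdForm.antidiagonal 2).over E) 0 1; 0, (1 : E), 0; ((StdForm.antidiagonal 2).over E) 1 0, 0, ((StdForm.antidiagonal 2).over E) 1 1] : Matrix (Fin 3) (Fin 3) E) L₃ →
          mapGL (endoGL (γ₂, u)) L₃ = L₃ → ∀ b : ℕ, (∀ c : E, (Pi.single 1 c : Fin 3 → E) ∈ L₃ ↔ Valued.v c ≤ Valued.v ϖ ^ b) → b ≤ R)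
        (_hfinF' : {L₃ : Submodule 𝒪[E] (Fin 3 → E) | IsSelfDualLattice σ ϖ (!![(Matrix.diagonal dg) 0 0, 0, (Matrix.diagonal dg) 0 1; 0, η, 0; (Matrix.diagonal dg) 1 0, 0, (Matrix.diagonal dg) 1 1] : Matrix (Fin 3) (Fin 3) E) L₃ ∧ mapGL (endoGL (γ₁, u)) L₃ = L₃}.Finite)
        (_hR' : ∀ L₃ : Submodule 𝒪[E] (Fin 3 → E), IsSelfDualLattice σ ϖ (!![(Matrix.diagonal dg) 0 0, 0, (Matrix.diagonal dg) 0 1; 0, η, 0; (Matrix.diagonal dg) 1 0, 0, (Matrix.diagonal dg) 1 1] : Matrix (Fin 3) (Fin 3) E) L₃ →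
          mapGL (endoGL (γ₁, u)) L₃ = L₃ → ∀ b : ℕ, (∀ c : E, (Pi.single 1 c : Fin 3 → E) ∈ L₃ ↔ Valued.v c ≤ Valued.v ϖ ^ b) → b ≤ R')
        (_hJ : ¬ IsOrd ρ α (jE ϖ ^ (J + 1)) lam) (_hfinLS : ∀ j a, (levelSet ρ Θ α (jE ϖ) h j a).Finite) (_hfinLS' : ∀ j a, (levelSet ρ Θ α (jE ϖ) h' j a).Finite)
        (_hf : ∀ (b j : ℕ) (Λ : AddSubgroup M) (x₀ : M) (r : E), 1 ≤ b → x₀ ≠ 0 → (∀ x, x ∈ Λ ↔ ∃ z, IsOrd ρ α (jE ϖ ^ j) z ∧ x = x₀ * z) →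
          IsOrd ρ α (jE ϖ ^ j) (dualGen ρ Θ α (jE ϖ ^ j) h x₀) → ¬ IsOrd ρ α (jE ϖ ^ j) (dualGen ρ Θ α (jE ϖ ^ j) h x₀ / jE ϖ) → Valued.v (dualGen ρ Θ α (jE ϖ ^ j) h x₀) = Valued.v (jE ϖ) ^ b →
          (∀ b', (∀ x ∈ Λ, Valued.v (h * Θ x * b' + ρ (h * Θ x * b')) ≤ 1) → (lam - jE ((u : Matrix (Fin 1) (Fin 1) E) 0 0)) * b' ∈ Λ) → IsOrd ρ α (jE ϖ ^ j) lam →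
          jE r = glueUnit ρ Θ α (jE ϖ ^ j) h (jE ϖ) (jE 1) x₀ b →
          f b j Λ = Nat.card {x : 𝒪[E] ⧸ 𝓂[E] ^ (2 * b) // ∃ u' : 𝒪[E], Ideal.Quotient.mk (𝓂[E] ^ (2 * b)) u' = x ∧ Valued.v ((u' : E) * σ u' - r) ≤ Valued.v (ϖ ^ (2 * b))})
        (_hf' : ∀ (b j : ℕ) (Λ : AddSubgroup M) (x₀ : M) (r : E), 1 ≤ b → x₀ ≠ 0 → (∀ x, x ∈ Λ ↔ ∃ z, IsOrd ρ α (jE ϖ ^ j) z ∧ x = x₀ * z) →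
          IsOrd ρ α (jE ϖ ^ j) (dualGen ρ Θ α (jE ϖ ^ j) h' x₀) → ¬ IsOrd ρ α (jE ϖ ^ j) (dualGen ρ Θ α (jE ϖ ^ j) h' x₀ / jE ϖ) → Valued.v (dualGen ρ Θ α (jE ϖ ^ j) h' x₀) = Valued.v (jE ϖ) ^ b →
          (∀ b', (∀ x ∈ Λ, Valued.v (h' * Θ x * b' + ρ (h' * Θ x * b')) ≤ 1) → (lam - jE ((u : Matrix (Fin 1) (Fin 1) E) 0 0)) * b' ∈ Λ) → IsOrd ρ α (jE ϖ ^ j) lam →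
          jE r = glueUnit ρ Θ α (jE ϖ ^ j) h' (jE ϖ) (jE η) x₀ b →
          f' b j Λ = Nat.card {x : 𝒪[E] ⧸ 𝓂[E] ^ (2 * b) // ∃ u' : 𝒪[E], Ideal.Quotient.mk (𝓂[E] ^ (2 * b)) u' = x ∧ Valued.v ((u' : E) * σ u' - r) ≤ Valued.v (ϖ ^ (2 * b))}),
            ∑ b ∈ (Finset.Icc 1 R).filter (fun b => 2 * b = m), ∑ j ∈ Finset.range (J + 1), (if IsOrd ρ α (jE ϖ ^ j) lam then
                ((∑ᶠ Λ ∈ levelSetDep ρ Θ α (jE ϖ) h j b (lam - jE ((u : Matrix (Fin 1) (Fin 1) E) 0 0)) ∩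
                      {Λ | ∃ B : Submodule 𝒪[E] (Fin 2 → E), B.toAddSubgroup.map φ = Λ ∧
                        ∃ L₃ : Submodule 𝒪[E] (Fin 3 → E), IsSelfDualLattice σ ϖ (!![((StdForm.antidiagonal 2).over E) 0 0, 0, ((StdForm.antidiagonal 2).over E) 0 1; 0, (1 : E), 0; ((StdForm.antidiagonal 2).over E) 1 0, 0, ((StdForm.antidiagonal 2).over E) 1 1] : Matrix (Fin 3) (Fin 3) E) L₃ ∧
                          L₃ ⊓ LinearMap.ker ((LinearMap.proj (1 : Fin 3) : (Fin 3 → E) →ₗ[E] E).restrictScalars 𝒪[E]) =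
                            B.map ((Matrix.toLin' (!![1, 0; 0, 0; 0, 1] : Matrix (Fin 3) (Fin 2) E)).restrictScalars 𝒪[E]) ∧
                          (∀ c : E, (Pi.single 1 c : Fin 3 → E) ∈ L₃ ↔ Valued.v c ≤ Valued.v ϖ ^ b) ∧
                          (LatticeNearTransvShell ϖ (d % 2) (mstarOfRecord d) ((((endoGL (γ₂, u) : GL (Fin 3) E) : Matrix (Fin 3) (Fin 3) E) - 1)) L₃ ∧
                            {z : E | ∃ y ∈ L₃, Valued.v ((ϖ ^ (mstarOfRecord d))⁻¹ * (z - pairing σ (!![((StdForm.antidiagonal 2).over E) 0 0, 0, ((StdForm.antidiagonal 2).over E) 0 1; 0, (1 : E), 0; ((StdForm.antidiagonal 2).over E) 1 0, 0, ((StdForm.antidiagonal 2).over E) 1 1] : Matrix (Fin 3) (Fin 3) E) y (((((endoGL (γ₂, u) : GL (Fin 3) E) : Matrix (Fin 3) (Fin 3) E) - 1)) *ᵥ y))) ≤ 1} =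
                              valueSetMod σ ϖ (mstarOfRecord d) (xPlus σ ϖ d))}, f b j Λ : ℕ) : ℤ) -
                  ((∑ᶠ Λ ∈ levelSetDep ρ Θ α (jE ϖ) h j b (lam - jE ((u : Matrix (Fin 1) (Fin 1) E) 0 0)) ∩
                      {Λ | ∃ B : Submodule 𝒪[E] (Fin 2 → E), B.toAddSubgroup.map φ = Λ ∧
                        ∃ L₃ : Submodule 𝒪[E] (Fin 3 → E), IsSelfDualLattice σ ϖ (!![((StdForm.antidiagonal 2).over E) 0 0, 0, ((StdForm.antidiagonal 2).over E) 0 1; 0, (1 : E), 0; ((StdForm.antidiagonal 2).over E) 1 0, 0, ((StdForm.antidiagonal 2).over E) 1 1] : Matrix (Fin 3) (Fin 3) E) L₃ ∧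
                          L₃ ⊓ LinearMap.ker ((LinearMap.proj (1 : Fin 3) : (Fin 3 → E) →ₗ[E] E).restrictScalars 𝒪[E]) =
                            B.map ((Matrix.toLin' (!![1, 0; 0, 0; 0, 1] : Matrix (Fin 3) (Fin 2) E)).restrictScalars 𝒪[E]) ∧
                          (∀ c : E, (Pi.single 1 c : Fin 3 → E) ∈ L₃ ↔ Valued.v c ≤ Valued.v ϖ ^ b) ∧
                          (LatticeNearTransvShell ϖ (d % 2) (mcOfRecord d) ((((endoGL (γ₂, u) : GL (Fin 3) E) : Matrix (Fin 3) (Fin 3) E) - 1)) L₃ ∧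
                            ¬ {z : E | ∃ y ∈ L₃, Valued.v ((ϖ ^ (mstarOfRecord d))⁻¹ * (z - pairing σ (!![((StdForm.antidiagonal 2).over E) 0 0, 0, ((StdForm.antidiagonal 2).over E) 0 1; 0, (1 : E), 0; ((StdForm.antidiagonal 2).over E) 1 0, 0, ((StdForm.antidiagonal 2).over E) 1 1] : Matrix (Fin 3) (Fin 3) E) y (((((endoGL (γ₂, u) : GL (Fin 3) E) : Matrix (Fin 3) (Fin 3) E) - 1)) *ᵥ y))) ≤ 1} =
                              valueSetMod σ ϖ (mstarOfRecord d) (xPlus σ ϖ d))}, f b j Λ : ℕ) : ℤ) else 0) =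
            ∑ b ∈ (Finset.Icc 1 R').filter (fun b => 2 * b = m), ∑ j ∈ Finset.range (J + 1), (if IsOrd ρ α (jE ϖ ^ j) lam then
                ((∑ᶠ Λ ∈ levelSetDep ρ Θ α (jE ϖ) h' j b (lam - jE ((u : Matrix (Fin 1) (Fin 1) E) 0 0)) ∩
                      {Λ | ∃ B : Submodule 𝒪[E] (Fin 2 → E), B.toAddSubgroup.map φ' = Λ ∧
                        ∃ L₃ : Submodule 𝒪[E] (Fin 3 → E), IsSelfDualLattice σ ϖ (!![(Matrix.diagonal dg) 0 0, 0, (Matrix.diagonal dg) 0 1; 0, η, 0; (Matrix.diagonal dg) 1 0, 0, (Matrix.diagonal dg) 1 1] : Matrix (Fin 3) (Fin 3) E) L₃ ∧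
                          L₃ ⊓ LinearMap.ker ((LinearMap.proj (1 : Fin 3) : (Fin 3 → E) →ₗ[E] E).restrictScalars 𝒪[E]) =
                            B.map ((Matrix.toLin' (!![1, 0; 0, 0; 0, 1] : Matrix (Fin 3) (Fin 2) E)).restrictScalars 𝒪[E]) ∧
                          (∀ c : E, (Pi.single 1 c : Fin 3 → E) ∈ L₃ ↔ Valued.v c ≤ Valued.v ϖ ^ b) ∧
                          (LatticeNearTransvShell ϖ (d % 2) (mstarOfRecord d) ((((endoGL (γ₁, u) : GL (Fin 3) E) : Matrix (Fin 3) (Fin 3) E) - 1)) L₃ ∧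
                            {z : E | ∃ y ∈ L₃, Valued.v ((ϖ ^ (mstarOfRecord d))⁻¹ * (z - pairing σ (!![(Matrix.diagonal dg) 0 0, 0, (Matrix.diagonal dg) 0 1; 0, η, 0; (Matrix.diagonal dg) 1 0, 0, (Matrix.diagonal dg) 1 1] : Matrix (Fin 3) (Fin 3) E) y (((((endoGL (γ₁, u) : GL (Fin 3) E) : Matrix (Fin 3) (Fin 3) E) - 1)) *ᵥ y))) ≤ 1} =
                              valueSetMod σ ϖ (mstarOfRecord d) (xPlus σ ϖ d))}, f' b j Λ : ℕ) : ℤ) -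
                  ((∑ᶠ Λ ∈ levelSetDep ρ Θ α (jE ϖ) h' j b (lam - jE ((u : Matrix (Fin 1) (Fin 1) E) 0 0)) ∩
                      {Λ | ∃ B : Submodule 𝒪[E] (Fin 2 → E), B.toAddSubgroup.map φ' = Λ ∧
                        ∃ L₃ : Submodule 𝒪[E] (Fin 3 → E), IsSelfDualLattice σ ϖ (!![(Matrix.diagonal dg) 0 0, 0, (Matrix.diagonal dg) 0 1; 0, η, 0; (Matrix.diagonal dg) 1 0, 0, (Matrix.diagonal dg) 1 1] : Matrix (Fin 3) (Fin 3) E) L₃ ∧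
                          L₃ ⊓ LinearMap.ker ((LinearMap.proj (1 : Fin 3) : (Fin 3 → E) →ₗ[E] E).restrictScalars 𝒪[E]) =
                            B.map ((Matrix.toLin' (!![1, 0; 0, 0; 0, 1] : Matrix (Fin 3) (Fin 2) E)).restrictScalars 𝒪[E]) ∧
                          (∀ c : E, (Pi.single 1 c : Fin 3 → E) ∈ L₃ ↔ Valued.v c ≤ Valued.v ϖ ^ b) ∧
                          (LatticeNearTransvShell ϖ (d % 2) (mcOfRecord d) ((((endoGL (γ₁, u) : GL (Fin 3) E) : Matrix (Fin 3) (Fin 3) E) - 1)) L₃ ∧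
                            ¬ {z : E | ∃ y ∈ L₃, Valued.v ((ϖ ^ (mstarOfRecord d))⁻¹ * (z - pairing σ (!![(Matrix.diagonal dg) 0 0, 0, (Matrix.diagonal dg) 0 1; 0, η, 0; (Matrix.diagonal dg) 1 0, 0, (Matrix.diagonal dg) 1 1] : Matrix (Fin 3) (Fin 3) E) y (((((endoGL (γ₁, u) : GL (Fin 3) E) : Matrix (Fin 3) (Fin 3) E) - 1)) *ᵥ y))) ≤ 1} =
                              valueSetMod σ ϖ (mstarOfRecord d) (xPlus σ ϖ d))}, f' b j Λ : ℕ) : ℤ) else 0) := by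
  intro E M _ _ _ _ _ _ _ _ _ _ σ ϖ d tE hD hσσ h2 jE ρ Θ α lam hρρ hvρ hρj hjv hjfix hΘj hΘΘ hΘρ hvΘ hα hα1 hint hΘlam hvlam hbasis hU hτ hσres hres hΘne hDM hjiso hq
    hjpow hEval hϖmax γ₂ u hdet htr hirr hlam2 hρlam m jl hm hjl hs hp hNm hu1N hlam1 hu hum hg1 P₁ dg η γ₁ hΓ hΓ' hA hdg1 hdgσ hησ hη1 hηN hγ₁ hA12
    φ h φ' h' hφs hφi hφo hφγ hform hΘh hh hhyper hφ's hφ'i hφ'o hφ'γ hform' hΘh' hh' J R R' f f' hfinF hR hfinF' hR' hJ hfinLS hfinLS' hf hf'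
  -- `m ≤ jl` (ultrametric: `|μ − ρμ| ≤ |μ|`)
  have hmjl : m ≤ jl := by
    have h1 : Valued.v ((lam - jE ((u : Matrix (Fin 1) (Fin 1) E) 0 0)) - ρ (lam - jE ((u : Matrix (Fin 1) (Fin 1) E) 0 0))) ≤
        Valued.v (lam - jE ((u : Matrix (Fin 1) (Fin 1) E) 0 0)) :=
      (Valuation.map_sub _ _ _).trans (max_le le_rfl (by rw [hvρ]))
    rw [hm, hjl] at h1
    have := WithZero.exp_le_exp.1 h1; omega
  -- literal 1: the hyperbolic block `((Φ₂).over E, 1)` in the identity frame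
  have hH₂ : IsUnit ((StdForm.antidiagonal 2).over E).det := by rw [det_antidiagonal_two]; exact isUnit_one.neg
  have hH₂σ : ((((StdForm.antidiagonal 2).over E).map σ))ᵀ = (StdForm.antidiagonal 2).over E := by rw [StdForm.over_map, StdForm.transpose_over]
  have hΓ₁ : (1 : GL (Fin 3) E) * endoGL (γ₂, u) * 1⁻¹ ∈ unitaryGroupOfForm σ ((StdForm.antidiagonal 3).over E) := by rwa [one_mul, inv_one, mul_one]
  obtain ⟨hW0, hV, hRH⟩ := hWR E M σ ϖ d tE hD hσσ h2 jE ρ Θ α lam hρρ hvρ hρj hjv hjfix hΘj hΘΘ hΘρ hvΘ hα hα1 hint hΘlam hvlam hbasis hU hτ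
    hσres hres hΘne hDM hjiso hq hjpow hEval hϖmax γ₂ u hdet htr hirr hlam2 hρlam m jl hm hjl hs hp hNm hu1N hlam1 hu hum ((StdForm.antidiagonal 2).over E) 1 hH₂ hH₂σ
    (by rw [map_one]) (map_one σ) 1 (formCongr_one_antidiagonal_three_eq_endoShape_two σ) hΓ₁ φ h hφs hφi hφo hφγ hform hΘh hh J R f hfinF hR hJ hfinLS hf
  have hjlJ : jl ≤ J := by by_contra hc; exact hJ ((hW0 (J + 1)).2 (by omega))
  -- literal 2: the anisotropic block `(diag dg, η)` in the frame `P₁`; `tr ∕ det γ₁ = tr ∕ det γ₂`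
  have htr₁ : (γ₁ : Matrix (Fin 2) (Fin 2) E).trace = (γ₂ : Matrix (Fin 2) (Fin 2) E).trace := by
    rw [Matrix.trace_eq_neg_charpoly_coeff, Matrix.trace_eq_neg_charpoly_coeff, hA12]
  have hdet₁ : (γ₁ : Matrix (Fin 2) (Fin 2) E).det = (γ₂ : Matrix (Fin 2) (Fin 2) E).det := by
    rw [Matrix.det_eq_sign_charpoly_coeff, Matrix.det_eq_sign_charpoly_coeff, hA12]
  have hH₂' : IsUnit (Matrix.diagonal dg).det := by
    rw [Matrix.det_diagonal]; refine isUnit_iff_ne_zero.2 (Finset.prod_ne_zero_iff.2 fun i _ h0 => ?_)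
    have h1 := hdg1 i; rw [h0, map_zero] at h1; exact zero_ne_one h1
  have hH₂σ' : ((Matrix.diagonal dg).map σ)ᵀ = Matrix.diagonal dg := by
    rw [Matrix.diagonal_map (map_zero _), Matrix.diagonal_transpose]; exact congrArg Matrix.diagonal (funext hdgσ)
  obtain ⟨-, hV', hRA⟩ := hWR E M σ ϖ d tE hD hσσ h2 jE ρ Θ α lam hρρ hvρ hρj hjv hjfix hΘj hΘΘ hΘρ hvΘ hα hα1 hint hΘlam hvlam hbasis hU hτ
    hσres hres hΘne hDM hjiso hq hjpow hEval hϖmax γ₁ u (by rw [hdet₁]; exact hdet) (by rw [htr₁, hdet₁]; exact htr) (by rw [htr₁, hdet₁]; exact hirr)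
    (by rw [htr₁, hdet₁]; exact hlam2) (by rw [htr₁]; exact hρlam) m jl hm hjl (by rw [htr₁]; exact hs) (by rw [htr₁, hdet₁]; exact hp) hNm hu1N hlam1 hu hum
    (Matrix.diagonal dg) η hH₂' hH₂σ' hη1 hησ P₁ hA hΓ' φ' h' hφ's hφ'i hφ'o hφ'γ hform' hΘh' hh' J R' f' hfinF' hR' hJ hfinLS' hf'
  -- the anisotropy of literal 2, from the frame
  have han : ¬ ∃ x : M, x ≠ 0 ∧ h' * Θ x * x + ρ (h' * Θ x * x) = 0 := by
    rintro ⟨x, hx0, hx⟩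
    obtain ⟨y, rfl⟩ := hφ'o x
    have hpair : pairing σ (Matrix.diagonal dg) y y = 0 := jE.injective (by rw [hform', hx, map_zero])
    rw [pairing_diagonal_two_self] at hpair
    have hAn := anisotropic_of_frame σ det_antidiagonal_three P₁ hA (hdgσ 1) hηN
    by_cases hy0 : y 0 = 0
    · have hy1 : y 1 ≠ 0 := by
        intro hy1
        apply hx0
        have hy : y = 0 := by
          ext i
          fin_cases i
          · exact hy0
          · exact hy1
        rw [hy, map_zero]
      rw [hy0, map_zero, zero_mul, zero_mul, zero_add] at hpair
      have hd1 : dg 1 = 0 := by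
        rcases mul_eq_zero.1 hpair with h01 | h2'
        · exact (mul_eq_zero.1 h01).elim (fun h3 => absurd ((map_eq_zero σ).1 h3) hy1) id
        · exact absurd h2' hy1
      have h1 := hdg1 1; rw [hd1, map_zero] at h1; exact zero_ne_one h1
    · apply hAn (y 1 / y 0)
      have hN : y 0 * σ (y 0) ≠ 0 := mul_ne_zero hy0 ((map_ne_zero σ).2 hy0)
      refine (mul_eq_zero.1 ?_).resolve_right hN
      have hσy0 : σ (y 0) ≠ 0 := (map_ne_zero σ).2 hy0
      have e : (dg 0 + dg 1 * (y 1 / y 0 * σ (y 1 / y 0))) * (y 0 * σ (y 0)) = σ (y 0) * dg 0 * y 0 + σ (y 1) * dg 1 * y 1 := by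
        rw [map_div₀]; field_simp
      rw [e, hpair]
  -- the abstract reduction (★ `rowSum_eq_rowSum_of_window`) at the two literals' summand families
  exact rowSum_eq_rowSum_of_window (fun j => IsOrd ρ α (jE ϖ ^ j) lam) _ _ J R R' jl m d hW0 hjlJ hmjl
    (fun b j hb hbm hj => hV b j hb hbm (Or.inl hj)) (fun b j hb hbm hbj hpar => hV b j hb hbm (Or.inr (Or.inl ⟨hbj, hpar⟩)))
    (fun b j hb hbm hjl' => hV b j hb hbm (Or.inr (Or.inr (Or.inl hjl')))) hRH
    (fun b j hb hbm hj => hV' b j hb hbm (Or.inl hj)) (fun b j hb hbm hbj hpar => hV' b j hb hbm (Or.inr (Or.inl ⟨hbj, hpar⟩)))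
    (fun b j hb hbm hjl' => hV' b j hb hbm (Or.inr (Or.inr (Or.inl hjl'))))
    (fun b j hb hbm hfar hpar => hV' b j hb hbm (Or.inr (Or.inr (Or.inr ⟨han, hfar, hpar⟩)))) hRA (fun b hb hbm => hcore E M σ ϖ d tE hD hσσ h2 jE ρ Θ α lam hρρ hvρ hρj hjv hjfix hΘj hΘΘ
      hΘρ hvΘ hα hα1 hint hΘlam hvlam hbasis hU hτ hσres hres hΘne hDM hjiso hq hjpow hEval hϖmax γ₂ u hdet htr hirr hlam2 hρlam m jl hm hjl hs hp hNm hu1N hlam1 hu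
      hum hg1 P₁ dg η γ₁ hΓ hΓ' hA hdg1 hdgσ hησ hη1 hηN hγ₁ hA12 φ h φ' h' hφs hφi hφo hφγ hform hΘh hh hhyper hφ's hφ'i hφ'o hφ'γ hform' hΘh' hh' J R R' f f' hfinF hR
      hfinF' hR' hJ hfinLS hfinLS' hf hf' b hb hbm han)

end Summit.HodgeConjecture.HodgeConjecture.Cruxes.H413.F0P3cDyRamRowOfCore

end
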